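import Mathlib
import HarnessLib
import Summits.ValiantsHypothesis.ValiantsHypothesis.Theorems.LacunarySymmetroidMatrixDescartesOsculationLawPeelRankTwoBranchFormulas

/-!
# ValiantsHypothesis / LacunarySymmetroid — crux `MatrixDescartes` (stmt-ValiantsHypothesis-18050, V1),
# line `Cruxes/MatrixDescartes/Lines/osculation_law.lean` («osculation-law»), stub `stub_peel` at RANK TWO:
# REGULARITY OF A BRANCH ON AN OWN-CUT-FREE ARC (step (B4b) of HOME/lmr/NOTE-p7g12-peel-r2-plan.md)

The rank-two branch `β_σ` (`σ = ±1`) of `a(t) b² + e(t) b + f(t) = 0` is the function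
`β t = if a(t) = 0 then −f(t)/e(t) else (−e(t) + σ√Δ(t))/(2a(t))` (`Δ = e² − 4af ≥ 0`); it is passed here as an
argument `β` with its defining equation `hβ` (no definition is introduced).  On an open interval `I = (L, U)` on
which branch `σ` neither ESCAPES (`a ≠ 0 ∨ σ·e > 0`) nor VANISHES (`f = 0 ⇒ σ·e < 0`), and which carries one point
where `β > 0`:

* `branch_root` — `a β² + e β + f = 0`; `branch_continuousAt` — `β` is continuous (through regular poles it agrees
  with the citardauq form `−2f/(e + σ√Δ)`);
* `branch_pos` — `β > 0` on `I` (it never vanishes, intermediate value theorem);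
* `branch_discr_pos` — `Δ > 0` at the non-poles of `I`, granted that no double `b`-root lies in the open quadrant
  above `I` (hypothesis `hnd`, supplied by `OsculationPeel.false_of_double_root` under the stub's general position);
* `branch_contDiffAt` — `β` is smooth on `I`; `branch_two_mul_add_ne` — `∂_bΦ = 2aβ + e ≠ 0` on `I`;
* `branch_hasDerivAt` — the package `HasDerivAt β (deriv β t) t`, `HasDerivAt (deriv β) (deriv (deriv β) t) t`
  consumed by the branch-arc engine `OsculationPeel.card_roots_filter_branchArc_le_two`.

Honest framing: bookkeeping for an OPEN stub; nothing here bears on `stub_peel`, the LAW, `MatrixDescartes` or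
`VP ≠ VNP`.  No definitions, no named facts; Mathlib + `…PeelRankTwoBranchFormulas`.
-/

-- `Summit.ValiantsHypothesis.ValiantsHypothesis.…` is the tree's mandated single-conjunct layout (Sub = Summit).
set_option linter.dupNamespace false

noncomputable section

namespace Summit.ValiantsHypothesis.ValiantsHypothesis.Theorems.LacunarySymmetroidMatrixDescartes

open Polynomial Set
open scoped BigOperators Topology

namespace OsculationPeel

section Branch

variable (a e f : ℝ[X]) (σ : ℝ) (β : ℝ → ℝ)
  (hβ : ∀ t, β t = if a.eval t = 0 then -f.eval t / e.eval t
    else (-e.eval t + σ * Real.sqrt (e.eval t ^ 2 - 4 * a.eval t * f.eval t)) / (2 * a.eval t))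

include hβ in
/-- **The branch solves the quadratic**: `a β² + e β + f = 0` wherever branch `σ` does not escape. [folklore] -/
theorem branch_root (hΔ : ∀ t, 4 * a.eval t * f.eval t ≤ e.eval t ^ 2) (hσ : σ = 1 ∨ σ = -1) {t : ℝ}
    (hesc : a.eval t ≠ 0 ∨ 0 < σ * e.eval t) :
    a.eval t * β t ^ 2 + e.eval t * β t + f.eval t = 0 := by
  by_cases ha : a.eval t = 0
  · have he : e.eval t ≠ 0 := by
      rcases hesc with h | h
      · exact absurd ha h
      · rintro h0; rw [h0, mul_zero] at h; exact lt_irrefl _ h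
    rw [hβ, if_pos ha, ha]
    field_simp
    ring
  · rw [hβ, if_neg ha]
    exact quad_r_eq_zero ha (hΔ t) hσ

include hβ in
/-- **Continuity**: `β` is continuous at every point where branch `σ` does not escape (off the poles by the
explicit formula; at a regular pole it coincides near the pole with `−2f/(e + σ√Δ)`). [folklore] -/
theorem branch_contDiffAt_pole (ha0 : a ≠ 0) (hΔ : ∀ t, 4 * a.eval t * f.eval t ≤ e.eval t ^ 2)
    (hσ : σ = 1 ∨ σ = -1) {t : ℝ} (ha : a.eval t = 0) (hσe : 0 < σ * e.eval t) : ContDiffAt ℝ ⊤ β t := by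
  have he : e.eval t ≠ 0 := by rintro h0; rw [h0, mul_zero] at hσe; exact lt_irrefl _ hσe
  -- `Δ(t) = e(t)² > 0` and `e + σ√Δ = 2e ≠ 0` at the pole
  have hΔt : 0 < e.eval t ^ 2 - 4 * a.eval t * f.eval t := by rw [ha]; nlinarith [mul_self_pos.2 he]
  have hσabs : σ * |e.eval t| = e.eval t := by
    rcases hσ with rfl | rfl
    · rw [one_mul] at hσe ⊢; exact abs_of_pos hσe
    · have : e.eval t < 0 := by linarith
      rw [abs_of_neg this]; ring
  have hden : e.eval t + σ * Real.sqrt (e.eval t ^ 2 - 4 * a.eval t * f.eval t) ≠ 0 := by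
    rw [ha, mul_zero, zero_mul, sub_zero, Real.sqrt_sq_eq_abs, hσabs]
    intro h; apply he; linarith
  -- `β = ρ` near `t`
  have hcont : ContinuousAt (fun s => e.eval s + σ * Real.sqrt (e.eval s ^ 2 - 4 * a.eval s * f.eval s)) t :=
    (e.continuous.continuousAt.add (continuousAt_const.mul (Real.continuous_sqrt.continuousAt.comp
      ((e.continuous.pow 2).sub ((continuous_const.mul a.continuous).mul f.continuous)).continuousAt)))
  have hev : β =ᶠ[𝓝 t] fun s => -2 * f.eval s / (e.eval s + σ * Real.sqrt (e.eval s ^ 2 - 4 * a.eval s * f.eval s)) := by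
    filter_upwards [eventually_eval_ne_zero a ha0 t, hcont.eventually_ne hden] with s hs hsden
    by_cases hst : s = t
    · subst hst
      rw [hβ, if_pos ha, rho_at_pole ha hσ hσe]
    · rw [hβ, if_neg (hs hst)]
      exact r_eq_rho (hs hst) (hΔ s) hσ hsden
  exact (contDiffAt_rho a e f σ t hΔt hden).congr_of_eventuallyEq hev

include hβ in
/-- Off the poles `β` is continuous (no sign condition on `Δ`). [folklore] -/
theorem branch_continuousAt_offpole {t : ℝ} (ha : a.eval t ≠ 0) : ContinuousAt β t := by
  have hev : β =ᶠ[𝓝 t] fun s => (-e.eval s + σ * Real.sqrt (e.eval s ^ 2 - 4 * a.eval s * f.eval s)) / (2 * a.eval s) := by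
    filter_upwards [a.continuous.continuousAt.eventually_ne ha] with s hs
    rw [hβ, if_neg hs]
  exact (continuousAt_r a e f σ t ha).congr_of_eventuallyEq hev

include hβ in
/-- **Continuity on the arc** (both cases). [folklore] -/
theorem branch_continuousAt (ha0 : a ≠ 0) (hΔ : ∀ t, 4 * a.eval t * f.eval t ≤ e.eval t ^ 2)
    (hσ : σ = 1 ∨ σ = -1) {t : ℝ} (hesc : a.eval t ≠ 0 ∨ 0 < σ * e.eval t) : ContinuousAt β t := by
  by_cases ha : a.eval t = 0
  · have hσe : 0 < σ * e.eval t := by rcases hesc with h | h; exact absurd ha h; exact h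
    exact (branch_contDiffAt_pole a e f σ β hβ ha0 hΔ hσ ha hσe).continuousAt
  · exact branch_continuousAt_offpole a e f σ β hβ ha

include hβ in
/-- **Positivity on an own-cut-free arc**: if branch `σ` neither escapes nor vanishes on `(L, U)` and is positive at
one point of it, it is positive throughout. [folklore] -/
theorem branch_pos (ha0 : a ≠ 0) (hΔ : ∀ t, 4 * a.eval t * f.eval t ≤ e.eval t ^ 2) (hσ : σ = 1 ∨ σ = -1)
    {L U : ℝ} (hesc : ∀ t, L < t → t < U → a.eval t ≠ 0 ∨ 0 < σ * e.eval t)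
    (hzero : ∀ t, L < t → t < U → f.eval t = 0 → σ * e.eval t < 0)
    {t₀ : ℝ} (hL₀ : L < t₀) (hU₀ : t₀ < U) (hpos₀ : 0 < β t₀) :
    ∀ t, L < t → t < U → 0 < β t := by
  -- `β` never vanishes on the arc
  have hne : ∀ t, L < t → t < U → β t ≠ 0 := by
    intro t h1 h2 hβ0
    have hroot := branch_root a e f σ β hβ hΔ hσ (hesc t h1 h2)
    rw [hβ0] at hroot
    have hf : f.eval t = 0 := by simpa using hroot
    have hσe := hzero t h1 h2 hf
    by_cases ha : a.eval t = 0
    · rcases hesc t h1 h2 with h | h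
      · exact h ha
      · linarith
    · -- off a pole: `β = r_σ = 0` forces `σ√Δ = e`, i.e. `σ e = √Δ ≥ 0`
      rw [hβ, if_neg ha, div_eq_zero_iff, or_iff_left (mul_ne_zero two_ne_zero ha)] at hβ0
      have hσ2 : σ * σ = 1 := by rcases hσ with rfl | rfl <;> norm_num
      have : σ * e.eval t = Real.sqrt (e.eval t ^ 2 - 4 * a.eval t * f.eval t) := by
        have h' : σ * Real.sqrt (e.eval t ^ 2 - 4 * a.eval t * f.eval t) = e.eval t := by linarith
        calc σ * e.eval t = σ * (σ * Real.sqrt (e.eval t ^ 2 - 4 * a.eval t * f.eval t)) := by rw [h']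
          _ = (σ * σ) * Real.sqrt (e.eval t ^ 2 - 4 * a.eval t * f.eval t) := by ring
          _ = _ := by rw [hσ2, one_mul]
      have := Real.sqrt_nonneg (e.eval t ^ 2 - 4 * a.eval t * f.eval t)
      linarith
  -- intermediate value theorem
  intro t h1 h2
  by_contra hle
  push Not at hle
  have hlt : β t < 0 := lt_of_le_of_ne hle (hne t h1 h2)
  have hcont : ∀ s, L < s → s < U → ContinuousAt β s := fun s hs1 hs2 =>
    branch_continuousAt a e f σ β hβ ha0 hΔ hσ (hesc s hs1 hs2)
  rcases lt_or_gt_of_ne (show t ≠ t₀ by rintro rfl; linarith) with hlt' | hlt'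
  · have hc : ContinuousOn β (Icc t t₀) := fun s hs =>
      (hcont s (lt_of_lt_of_le h1 hs.1) (lt_of_le_of_lt hs.2 hU₀)).continuousWithinAt
    obtain ⟨z, hz, hz0⟩ := intermediate_value_Icc hlt'.le hc ⟨hlt.le, hpos₀.le⟩
    exact hne z (lt_of_lt_of_le h1 hz.1) (lt_of_le_of_lt hz.2 hU₀) hz0
  · have hc : ContinuousOn β (Icc t₀ t) := fun s hs =>
      (hcont s (lt_of_lt_of_le hL₀ hs.1) (lt_of_le_of_lt hs.2 h2)).continuousWithinAt
    obtain ⟨z, hz, hz0⟩ := intermediate_value_Icc' hlt'.le hc ⟨hlt.le, hpos₀.le⟩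
    exact hne z (lt_of_lt_of_le hL₀ hz.1) (lt_of_le_of_lt hz.2 h2) hz0

include hβ in
/-- **`Δ > 0` off the poles** wherever the branch is positive, granted no double `b`-root in the open quadrant
(hypothesis `hnd`). [folklore] -/
theorem branch_discr_pos (hΔ : ∀ t, 4 * a.eval t * f.eval t ≤ e.eval t ^ 2) (hσ : σ = 1 ∨ σ = -1) {t : ℝ}
    (hnd : ∀ b : ℝ, 0 < b → a.eval t * b ^ 2 + e.eval t * b + f.eval t = 0 → 2 * a.eval t * b + e.eval t = 0 → False)
    (ha : a.eval t ≠ 0) (hpos : 0 < β t) : 0 < e.eval t ^ 2 - 4 * a.eval t * f.eval t := by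
  by_contra hle
  have h0 : e.eval t ^ 2 - 4 * a.eval t * f.eval t = 0 := le_antisymm (not_lt.1 hle) (by linarith [hΔ t])
  have hroot := branch_root a e f σ β hβ hΔ hσ (Or.inl ha)
  apply hnd (β t) hpos hroot
  have hb : β t = (-e.eval t + σ * Real.sqrt (e.eval t ^ 2 - 4 * a.eval t * f.eval t)) / (2 * a.eval t) := by
    rw [hβ, if_neg ha]
  rw [hb, two_mul_r_add ha, h0, Real.sqrt_zero, mul_zero]

include hβ in
/-- **Smoothness on the arc**. [folklore] -/
theorem branch_contDiffAt (ha0 : a ≠ 0) (hΔ : ∀ t, 4 * a.eval t * f.eval t ≤ e.eval t ^ 2) (hσ : σ = 1 ∨ σ = -1)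
    {t : ℝ} (hesc : a.eval t ≠ 0 ∨ 0 < σ * e.eval t)
    (hΔt : a.eval t ≠ 0 → 0 < e.eval t ^ 2 - 4 * a.eval t * f.eval t) : ContDiffAt ℝ ⊤ β t := by
  by_cases ha : a.eval t = 0
  · have hσe : 0 < σ * e.eval t := by rcases hesc with h | h; exact absurd ha h; exact h
    exact branch_contDiffAt_pole a e f σ β hβ ha0 hΔ hσ ha hσe
  · have hev : β =ᶠ[𝓝 t] fun s => (-e.eval s + σ * Real.sqrt (e.eval s ^ 2 - 4 * a.eval s * f.eval s)) / (2 * a.eval s) := by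
      filter_upwards [a.continuous.continuousAt.eventually_ne ha] with s hs
      rw [hβ, if_neg hs]
    exact (contDiffAt_r a e f σ t ha (hΔt ha)).congr_of_eventuallyEq hev

include hβ in
/-- **`∂_bΦ ≠ 0` on the branch**: `2aβ + e = σ√Δ ≠ 0` off the poles (when `Δ > 0`) and `= e ≠ 0` at a regular pole.
[folklore] -/
theorem branch_two_mul_add_ne (hσ : σ = 1 ∨ σ = -1) {t : ℝ} (hesc : a.eval t ≠ 0 ∨ 0 < σ * e.eval t)
    (hΔt : a.eval t ≠ 0 → 0 < e.eval t ^ 2 - 4 * a.eval t * f.eval t) :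
    2 * a.eval t * β t + e.eval t ≠ 0 := by
  by_cases ha : a.eval t = 0
  · have hσe : 0 < σ * e.eval t := by rcases hesc with h | h; exact absurd ha h; exact h
    rw [ha, mul_zero, zero_mul, zero_add]
    rintro h0; rw [h0, mul_zero] at hσe; exact lt_irrefl _ hσe
  · rw [hβ, if_neg ha, two_mul_r_add ha]
    have hσ0 : σ ≠ 0 := by rcases hσ with rfl | rfl <;> norm_num
    exact mul_ne_zero hσ0 (Real.sqrt_ne_zero'.2 (hΔt ha))

/-- **The derivative package on an open arc**: smoothness at every point of `(L, U)` gives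
`HasDerivAt β (deriv β t) t` and `HasDerivAt (deriv β) (deriv (deriv β) t) t` there. [folklore] -/
theorem hasDerivAt_of_contDiffAt {L U : ℝ} (h : ∀ t, L < t → t < U → ContDiffAt ℝ ⊤ β t) {t : ℝ}
    (h1 : L < t) (h2 : t < U) :
    HasDerivAt β (deriv β t) t ∧ HasDerivAt (deriv β) (deriv (deriv β) t) t := by
  have hon : ContDiffOn ℝ ⊤ β (Ioo L U) := fun s hs => (h s hs.1 hs.2).contDiffWithinAt
  have hd : ContDiffOn ℝ ⊤ (deriv β) (Ioo L U) := hon.deriv_of_isOpen isOpen_Ioo le_top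
  have hmem : Ioo L U ∈ 𝓝 t := Ioo_mem_nhds h1 h2
  exact ⟨((hon.differentiableOn (by simp)).differentiableAt hmem).hasDerivAt,
    ((hd.differentiableOn (by simp)).differentiableAt hmem).hasDerivAt⟩

end Branch

end OsculationPeel

end Summit.ValiantsHypothesis.ValiantsHypothesis.Theorems.LacunarySymmetroidMatrixDescartes

end
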